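import Summits.CriticalPhenomena.Ising3DConformalLimit.Theorems.PerfectScreeningSubharmonicOffOriginOZSubharmonic
import Literature.Probability.LatticeModels.DirInvCorrLength
import HarnessLib

/-!
# The massive regime: Ornstein–Zernike asymptotics ⇒ eventual strict subharmonicity below `β_c`

Route `PerfectScreening`, crux r2 `SubharmonicOffOrigin` (stmt-CriticalPhenomena-1341), by-product
T2b (`Cruxes/SubharmonicOffOrigin/Disproof.lean` §(c): "massive regime `β < β_c`, `|x| ≫ ξ`:
TRUE (`ΔG ≈ m²G > 0`, Ornstein–Zernike)"; `STRATEGY-CENSUS.md` §6 D4, §8.4): the prose claim made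
a theorem, CONDITIONAL on the Ornstein–Zernike asymptotics of Campanino–Ioffe–Velenik (PTRF 125
(2003), Thm. A — eq. (1.3) — and Thm. B / abstract for the regularity of `ξ_β`), taken as an
explicit hypothesis written out in the tree's vocabulary (rate function `ξ` positively
`1`-homogeneous, positive, `C¹` off the origin, equal to `dirInvCorrLength 3 β` on `ℤ³`; prefactor
`Φ` dilation invariant, positive, continuous off the origin; `⟨σ₀σ_x⟩⁺_β·|x|·e^{ξ(x)}/Φ(x) → 1`
cofinitely); the same statement is proposed as the Literature named fact
`CIVOrnsteinZernikeAsymptotics3` (`Literature/Probability/LatticeModels/OrnsteinZernikeAsymptotics.lean`).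

* `tendsto_prefactor_ratio` — a degree-zero homogeneous prefactor, continuous and positive off the
  origin, is slowly varying on the lattice: `Φ(x + e)/Φ(x) → 1`;
* `tendsto_euclidNorm_ratio` — `|x + e|/|x| → 1` for the Euclidean norm;
* `subcritical_eventually_strictSubharmonic` — at any `β` with OZ asymptotics (CIV: every
  `0 < β < β_c(3)`), there are `c > 0` and `R` with `(6 + c)·⟨σ₀σ_x⟩⁺_β ≤ ∑_{y∼x} ⟨σ₀σ_y⟩⁺_β` for `‖x‖ > R`:
  the subcritical two-point function of `ℤ³` is EVENTUALLY UNIFORMLY STRICTLY lattice-subharmonic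
  (margin `c = m²/12`, `m = min_{‖u‖∞=1} ξ_β(u)` — the squared mass gap), by the model-free lemma
  `OZSubharmonic.exists_radius_strictSubharmonic_of_ratioAsymptotics`.

Contrast (the point of recording it): AT `β_c(3)` every uniform margin is refuted
(`not_uniformlyStrictSubharmonic`, exact balance `∑_{y∼x}G(y)/G(x) → 6` on every axis-parallel
line), so the subharmonicity that the crux asserts at `β_c` cannot be inherited from the massive
regime by a compactness/uniformity argument in `β ↑ β_c` — the margin `m(β)² → 0` closes exactly at
the critical point (the "critical window" of the census, now quantified).  With the temperature door
(`TemperatureDoor.subharmonicOffOrigin_of_subcritical'`) and the Bethe threshold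
(`Bethe.betheThreshold`) this completes the typed phase diagram of `SubH_β` on `ℤ³` short of the
crux itself: all `x ≠ 0` for `tanh β ≤ 1/5`; all large `x` (conditionally) for every `β < β_c`;
open at `β_c`.
-/

noncomputable section

open Filter Topology Metric Set

namespace Summit.CriticalPhenomena.Ising3DConformalLimit.Theorems.PerfectScreening.MassiveRegime

open Literature.Probability.LatticeModels
open Summit.CriticalPhenomena.Ising3DConformalLimit.Theorems.PerfectScreening.OZSubharmonic

variable {d : ℕ}

/-! ### Slowly varying prefactors -/

/-- **A degree-zero homogeneous prefactor is slowly varying on the lattice.** If `Φ : ℝ^d → ℝ` is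
invariant under positive dilations, continuous and strictly positive off the origin, then for every
fixed lattice vector `e`, `Φ(x + e)/Φ(x) → 1` as `x → ∞` in `ℤ^d`: `Φ(x + e) = Φ(x̂ + e/‖x‖)`,
`Φ(x) = Φ(x̂)` and `Φ` is uniformly continuous near the unit sphere, where it is bounded below. [folklore] -/
theorem tendsto_prefactor_ratio {Φ : (Fin d → ℝ) → ℝ}
    (hhom0 : ∀ c : ℝ, 0 < c → ∀ y, Φ (c • y) = Φ y) (hpos : ∀ y, y ≠ 0 → 0 < Φ y)
    (hcont : ContinuousOn Φ {0}ᶜ) (e : Fin d → ℝ) :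
    Tendsto (fun x : Fin d → ℤ => Φ ((fun j => (x j : ℝ)) + e) / Φ (fun j => (x j : ℝ)))
      cofinite (𝓝 1) := by
  -- positive lower bound `μ` of `Φ` on the unit sphere
  obtain ⟨μ, hμ, hμle⟩ : ∃ μ : ℝ, 0 < μ ∧ ∀ u : Fin d → ℝ, ‖u‖ = 1 → μ ≤ Φ u := by
    have hS : IsCompact (sphere (0 : Fin d → ℝ) 1) := isCompact_sphere 0 1
    have hS0 : sphere (0 : Fin d → ℝ) 1 ⊆ {0}ᶜ := by
      intro u hu h0
      rw [mem_sphere_zero_iff_norm] at hu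
      have h0' : u = 0 := h0
      rw [h0', norm_zero] at hu
      exact zero_ne_one hu
    by_cases hne : (sphere (0 : Fin d → ℝ) 1).Nonempty
    · obtain ⟨u₀, hu₀, hmin⟩ := hS.exists_isMinOn hne (hcont.mono hS0)
      refine ⟨Φ u₀, hpos u₀ (hS0 hu₀), fun u hu => ?_⟩
      exact isMinOn_iff.1 hmin u (mem_sphere_zero_iff_norm.2 hu)
    · exact ⟨1, one_pos, fun u hu => (hne ⟨u, mem_sphere_zero_iff_norm.2 hu⟩).elim⟩
  rw [Metric.tendsto_nhds]
  intro ε hε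
  -- uniform continuity tolerance `μ ε / 2` near the sphere
  obtain ⟨δ, hδ, hδhalf, hδu⟩ := sphere_uniform hcont (show 0 < μ * ε / 2 by positivity)
  have hnorm := tendsto_norm_cast_cofinite (d := d)
  filter_upwards [hnorm.eventually_ge_atTop ((‖e‖ + 1) / δ)] with x hx
  have hRpos : 0 < (‖e‖ + 1) / δ := by positivity
  -- abbreviations
  have hqpos : 0 < ‖(fun j => (x j : ℝ))‖ := lt_of_lt_of_le hRpos hx
  have hq0 : (fun j => (x j : ℝ)) ≠ 0 := norm_pos_iff.1 hqpos
  have hr : 0 < ‖(fun j => (x j : ℝ))‖⁻¹ := inv_pos.2 hqpos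
  -- rescale both points to the unit sphere
  have hu : ‖(‖(fun j => (x j : ℝ))‖⁻¹ • (fun j => (x j : ℝ)) : Fin d → ℝ)‖ = 1 := by
    rw [norm_smul, norm_inv, norm_norm, inv_mul_cancel₀ hqpos.ne']
  have h1 : Φ (fun j => (x j : ℝ)) = Φ (‖(fun j => (x j : ℝ))‖⁻¹ • (fun j => (x j : ℝ))) :=
    (hhom0 _ hr _).symm
  have h2 : Φ ((fun j => (x j : ℝ)) + e) =
      Φ (‖(fun j => (x j : ℝ))‖⁻¹ • ((fun j => (x j : ℝ)) + e)) := (hhom0 _ hr _).symm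
  have hdist : ‖(‖(fun j => (x j : ℝ))‖⁻¹ • ((fun j => (x j : ℝ)) + e) : Fin d → ℝ) -
      ‖(fun j => (x j : ℝ))‖⁻¹ • (fun j => (x j : ℝ))‖ ≤ δ := by
    rw [← smul_sub, add_sub_cancel_left, norm_smul, norm_inv, norm_norm]
    rw [inv_mul_le_iff₀ hqpos]
    have h3 : ‖e‖ + 1 ≤ δ * ‖(fun j => (x j : ℝ))‖ := by rwa [div_le_iff₀' hδ] at hx
    nlinarith [norm_nonneg e]
  have hclose := hδu _ _ hu hdist
  rw [Real.dist_eq] at hclose ⊢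
  have hΦu : μ ≤ Φ (‖(fun j => (x j : ℝ))‖⁻¹ • (fun j => (x j : ℝ))) := hμle _ hu
  have hΦpos : 0 < Φ (‖(fun j => (x j : ℝ))‖⁻¹ • (fun j => (x j : ℝ))) := lt_of_lt_of_le hμ hΦu
  rw [h1, h2]
  rw [div_sub_one hΦpos.ne', abs_div, abs_of_pos hΦpos, div_lt_iff₀ hΦpos]
  calc |Φ (‖(fun j => (x j : ℝ))‖⁻¹ • ((fun j => (x j : ℝ)) + e)) -
        Φ (‖(fun j => (x j : ℝ))‖⁻¹ • (fun j => (x j : ℝ)))|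
      ≤ μ * ε / 2 := hclose
    _ < μ * ε := by linarith [mul_pos hμ hε]
    _ ≤ ε * Φ (‖(fun j => (x j : ℝ))‖⁻¹ • (fun j => (x j : ℝ))) := by
        rw [mul_comm]; exact mul_le_mul_of_nonneg_left hΦu hε.le

/-- Squared Euclidean length in coordinates dominates the squared sup norm: `‖y‖∞² ≤ ∑ⱼ yⱼ²`. [folklore] -/
theorem sq_norm_le_sum_sq (y : Fin d → ℝ) : ‖y‖ ^ 2 ≤ ∑ j : Fin d, (y j) ^ 2 := by
  rcases Nat.eq_zero_or_pos d with hd | hd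
  · subst hd
    simp [Pi.norm_def]
  · haveI : Nonempty (Fin d) := ⟨⟨0, hd⟩⟩
    obtain ⟨j, hj⟩ : ∃ j : Fin d, ‖y‖ = ‖y j‖ := by
      have h := Pi.norm_def y
      obtain ⟨j, -, hj⟩ := Finset.exists_mem_eq_sup (Finset.univ : Finset (Fin d))
        Finset.univ_nonempty (fun b => ‖y b‖₊)
      refine ⟨j, ?_⟩
      rw [h, hj, coe_nnnorm]
    rw [hj, Real.norm_eq_abs, sq_abs]
    exact Finset.single_le_sum (f := fun j => (y j) ^ 2) (fun i _ => sq_nonneg (y i))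
      (Finset.mem_univ j)

/-- **The Euclidean length is slowly varying on the lattice**: `√(∑(xⱼ+eⱼ)²) / √(∑ xⱼ²) → 1` as
`x → ∞` in `ℤ^d`, for every fixed `e`. [folklore] -/
theorem tendsto_euclidNorm_ratio (e : Fin d → ℝ) :
    Tendsto (fun x : Fin d → ℤ => Real.sqrt (∑ j, ((x j : ℝ) + e j) ^ 2) /
      Real.sqrt (∑ j, ((x j : ℝ)) ^ 2)) cofinite (𝓝 1) := by
  -- the ratio of squares tends to one: `∑(x+e)² / ∑x² = 1 + (2∑xe + ∑e²)/∑x²`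
  have hnorm := tendsto_norm_cast_cofinite (d := d)
  have hsq : Tendsto (fun x : Fin d → ℤ => (∑ j, ((x j : ℝ) + e j) ^ 2) / (∑ j, ((x j : ℝ)) ^ 2))
      cofinite (𝓝 1) := by
    -- bound `|ratio − 1| ≤ (2 ∑|eⱼ| ‖x‖ + ∑ eⱼ²)/‖x‖²`
    have hbound : ∀ x : Fin d → ℤ, 1 ≤ ‖(fun j => (x j : ℝ))‖ →
        |(∑ j, ((x j : ℝ) + e j) ^ 2) / (∑ j, ((x j : ℝ)) ^ 2) - 1| ≤
          (2 * (∑ j, |e j|) * ‖(fun j => (x j : ℝ))‖ + ∑ j, (e j) ^ 2) /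
            ‖(fun j => (x j : ℝ))‖ ^ 2 := by
      intro x hx
      have hS : ‖(fun j => (x j : ℝ))‖ ^ 2 ≤ ∑ j, ((x j : ℝ)) ^ 2 := sq_norm_le_sum_sq _
      have hSpos : 0 < ∑ j, ((x j : ℝ)) ^ 2 := lt_of_lt_of_le (by positivity) hS
      have hnum : (∑ j, ((x j : ℝ) + e j) ^ 2) - ∑ j, ((x j : ℝ)) ^ 2 =
          2 * ∑ j, (x j : ℝ) * e j + ∑ j, (e j) ^ 2 := by
        rw [Finset.mul_sum, ← Finset.sum_add_distrib, ← Finset.sum_sub_distrib]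
        refine Finset.sum_congr rfl fun j _ => ?_
        ring
      rw [div_sub_one hSpos.ne', abs_div, abs_of_pos hSpos, hnum]
      have hcross : |2 * ∑ j, (x j : ℝ) * e j + ∑ j, (e j) ^ 2| ≤
          2 * (∑ j, |e j|) * ‖(fun j => (x j : ℝ))‖ + ∑ j, (e j) ^ 2 := by
        have h1 : |∑ j, (x j : ℝ) * e j| ≤ (∑ j, |e j|) * ‖(fun j => (x j : ℝ))‖ := by
          calc |∑ j, (x j : ℝ) * e j| ≤ ∑ j, |(x j : ℝ) * e j| := Finset.abs_sum_le_sum_abs _ _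
            _ ≤ ∑ j, |e j| * ‖(fun j => (x j : ℝ))‖ := by
                refine Finset.sum_le_sum fun j _ => ?_
                rw [abs_mul, mul_comm]
                refine mul_le_mul_of_nonneg_left ?_ (abs_nonneg _)
                have := norm_le_pi_norm (fun j => (x j : ℝ)) j
                rwa [Real.norm_eq_abs] at this
            _ = (∑ j, |e j|) * ‖(fun j => (x j : ℝ))‖ := by rw [Finset.sum_mul]
        have h2 : 0 ≤ ∑ j, (e j) ^ 2 := Finset.sum_nonneg fun j _ => sq_nonneg _
        calc |2 * ∑ j, (x j : ℝ) * e j + ∑ j, (e j) ^ 2|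
            ≤ |2 * ∑ j, (x j : ℝ) * e j| + |∑ j, (e j) ^ 2| := abs_add_le _ _
          _ = 2 * |∑ j, (x j : ℝ) * e j| + ∑ j, (e j) ^ 2 := by
              rw [abs_mul, abs_of_pos (by norm_num : (0 : ℝ) < 2), abs_of_nonneg h2]
          _ ≤ 2 * ((∑ j, |e j|) * ‖(fun j => (x j : ℝ))‖) + ∑ j, (e j) ^ 2 := by linarith
          _ = 2 * (∑ j, |e j|) * ‖(fun j => (x j : ℝ))‖ + ∑ j, (e j) ^ 2 := by ring
      calc |2 * ∑ j, (x j : ℝ) * e j + ∑ j, (e j) ^ 2| / ∑ j, ((x j : ℝ)) ^ 2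
          ≤ (2 * (∑ j, |e j|) * ‖(fun j => (x j : ℝ))‖ + ∑ j, (e j) ^ 2) /
              ∑ j, ((x j : ℝ)) ^ 2 := by gcongr
        _ ≤ (2 * (∑ j, |e j|) * ‖(fun j => (x j : ℝ))‖ + ∑ j, (e j) ^ 2) /
              ‖(fun j => (x j : ℝ))‖ ^ 2 := by
            refine div_le_div_of_nonneg_left ?_ (by positivity) hS
            have : 0 ≤ ∑ j, (e j) ^ 2 := Finset.sum_nonneg fun j _ => sq_nonneg _
            positivity
    -- the majorant tends to zero
    have hmaj : Tendsto (fun x : Fin d → ℤ =>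
        (2 * (∑ j, |e j|) * ‖(fun j => (x j : ℝ))‖ + ∑ j, (e j) ^ 2) /
          ‖(fun j => (x j : ℝ))‖ ^ 2) cofinite (𝓝 0) := by
      have hinv : Tendsto (fun x : Fin d → ℤ => (‖(fun j => (x j : ℝ))‖)⁻¹) cofinite (𝓝 0) :=
        tendsto_inv_atTop_zero.comp hnorm
      have heq : ∀ x : Fin d → ℤ, 1 ≤ ‖(fun j => (x j : ℝ))‖ →
          (2 * (∑ j, |e j|) * ‖(fun j => (x j : ℝ))‖ + ∑ j, (e j) ^ 2) /
            ‖(fun j => (x j : ℝ))‖ ^ 2 =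
          2 * (∑ j, |e j|) * (‖(fun j => (x j : ℝ))‖)⁻¹ +
            (∑ j, (e j) ^ 2) * ((‖(fun j => (x j : ℝ))‖)⁻¹ * (‖(fun j => (x j : ℝ))‖)⁻¹) := by
        intro x hx
        have hpos : 0 < ‖(fun j => (x j : ℝ))‖ := by linarith
        field_simp
      have hlim : Tendsto (fun x : Fin d → ℤ => 2 * (∑ j, |e j|) * (‖(fun j => (x j : ℝ))‖)⁻¹ +
            (∑ j, (e j) ^ 2) * ((‖(fun j => (x j : ℝ))‖)⁻¹ * (‖(fun j => (x j : ℝ))‖)⁻¹))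
          cofinite (𝓝 0) := by
        have h := (hinv.const_mul (2 * ∑ j, |e j|)).add ((hinv.mul hinv).const_mul (∑ j, (e j) ^ 2))
        simpa using h
      refine hlim.congr' ?_
      filter_upwards [hnorm.eventually_ge_atTop 1] with x hx
      exact (heq x hx).symm
    -- squeeze
    rw [Metric.tendsto_nhds]
    intro ε hε
    have hmaj' := Metric.tendsto_nhds.1 hmaj ε hε
    filter_upwards [hmaj', hnorm.eventually_ge_atTop 1] with x hx h1
    rw [Real.dist_eq]
    rw [Real.dist_eq, sub_zero] at hx
    refine lt_of_le_of_lt (hbound x h1) ?_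
    exact lt_of_le_of_lt (le_abs_self _) hx
  -- take square roots
  have hsqrt := hsq.sqrt
  rw [Real.sqrt_one] at hsqrt
  refine hsqrt.congr' ?_
  filter_upwards with x
  rw [Real.sqrt_div' _ (Finset.sum_nonneg fun j _ => sq_nonneg _)]

/-! ### The subcritical two-point function of `ℤ³` -/

/-- **Eventual uniformly strict subharmonicity in the massive regime (conditional on the
Ornstein–Zernike asymptotics).** If at inverse temperature `β` the plus-state two-point function of
`ℤ³` has Ornstein–Zernike asymptotics `⟨σ₀σ_x⟩⁺_β · |x| · e^{ξ(x)} / Φ(x) → 1` (`x → ∞`) with a rate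
function `ξ` positively `1`-homogeneous, strictly positive and `C¹` off the origin and a prefactor `Φ`
dilation invariant, strictly positive and continuous off the origin — the conclusion of
Campanino–Ioffe–Velenik 2003, Thm. A/B, for every `0 < β < β_c(3)` — then there are `c > 0` and `R`
such that `(6 + c)·⟨σ₀σ_x⟩⁺_β ≤ ∑ᵢ (⟨σ₀σ_{x+eᵢ}⟩⁺_β + ⟨σ₀σ_{x−eᵢ}⟩⁺_β)` for all
`x ∈ ℤ³` with `‖x‖ > R`.  Proof: with `H(x) = Φ_β(x)/|x|` (slowly varying by
`tendsto_prefactor_ratio`, `tendsto_euclidNorm_ratio`) the CIV asymptotics are the ratio form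
`G/(H e^{−ξ_β}) → 1`, and `OZSubharmonic.exists_radius_strictSubharmonic_of_ratioAsymptotics`
applies with `d = 3`. [folklore] -/
theorem subcritical_eventually_strictSubharmonic {β : ℝ}
    (hOZ : ∃ ξ Φ : (Fin 3 → ℝ) → ℝ,
      (∀ c : ℝ, 0 < c → ∀ y, ξ (c • y) = c * ξ y) ∧ (∀ y, y ≠ 0 → 0 < ξ y) ∧
      ContDiffOn ℝ 1 ξ {0}ᶜ ∧ (∀ x : Site 3, ξ (fun j => (x j : ℝ)) = dirInvCorrLength 3 β x) ∧
      (∀ c : ℝ, 0 < c → ∀ y, Φ (c • y) = Φ y) ∧ (∀ y, y ≠ 0 → 0 < Φ y) ∧ ContinuousOn Φ {0}ᶜ ∧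
      Tendsto (fun x : Site 3 => twoPointPlus 3 β x * Real.sqrt (∑ j, ((x j : ℝ)) ^ 2) *
        Real.exp (ξ (fun j => (x j : ℝ))) / Φ (fun j => (x j : ℝ))) cofinite (𝓝 1)) :
    ∃ c : ℝ, 0 < c ∧ ∃ R : ℝ, ∀ x : Site 3, R < ‖x‖ →
      (6 + c) * twoPointPlus 3 β x ≤
        ∑ i : Fin 3, (twoPointPlus 3 β (x + Pi.single i 1) + twoPointPlus 3 β (x - Pi.single i 1)) := by
  obtain ⟨ξ, Φ, hhom, hξpos, hC1, -, hΦhom, hΦpos, hΦcont, hasym⟩ := hOZ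
  -- the prefactor model `H(x) = Φ(x) / |x|₂`
  set H : Site 3 → ℝ := fun x => Φ (fun j => (x j : ℝ)) / Real.sqrt (∑ j, ((x j : ℝ)) ^ 2)
    with hH_def
  have hnorm := tendsto_norm_cast_cofinite (d := 3)
  -- eventually `x ≠ 0` (as a real vector), hence `H > 0`
  have hne : ∀ᶠ x : Site 3 in cofinite, (fun j => (x j : ℝ)) ≠ 0 := by
    filter_upwards [hnorm.eventually_ge_atTop 1] with x hx
    intro h0
    rw [h0, norm_zero] at hx
    linarith
  have hsqrt_pos : ∀ x : Site 3, (fun j => (x j : ℝ)) ≠ 0 → 0 < Real.sqrt (∑ j, ((x j : ℝ)) ^ 2) := by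
    intro x hx
    apply Real.sqrt_pos.2
    have hS := sq_norm_le_sum_sq (fun j => (x j : ℝ))
    have hn : 0 < ‖(fun j => (x j : ℝ))‖ := norm_pos_iff.2 hx
    exact lt_of_lt_of_le (by positivity) hS
  have hHpos : ∀ᶠ x : Site 3 in cofinite, 0 < H x := by
    filter_upwards [hne] with x hx
    exact div_pos (hΦpos _ hx) (hsqrt_pos x hx)
  -- `H` is slowly varying
  have hratio : ∀ i : Fin 3, Tendsto (fun x => H (x + Pi.single i 1) / H x) cofinite (𝓝 1) := by
    intro i
    have hΦr := tendsto_prefactor_ratio hΦhom hΦpos hΦcont (Pi.single i (1 : ℝ))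
    have hNr := tendsto_euclidNorm_ratio (d := 3) (Pi.single i (1 : ℝ))
    have hNr' : Tendsto (fun x : Site 3 => Real.sqrt (∑ j, ((x j : ℝ)) ^ 2) /
        Real.sqrt (∑ j, ((x j : ℝ) + (Pi.single i (1 : ℝ) : Fin 3 → ℝ) j) ^ 2)) cofinite (𝓝 1) := by
      have h := hNr.inv₀ one_ne_zero
      rw [inv_one] at h
      refine h.congr' (Eventually.of_forall fun x => ?_)
      rw [inv_div]
    have hprod := hΦr.mul hNr'
    rw [one_mul] at hprod
    refine hprod.congr' (Eventually.of_forall fun x => ?_)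
    have hcast : (fun j => ((x + Pi.single i 1 : Site 3) j : ℝ)) =
        (fun j => (x j : ℝ)) + Pi.single i (1 : ℝ) := cast_add_single x i
    have hs : (∑ j, (((x + Pi.single i 1 : Site 3) j : ℝ)) ^ 2) =
        ∑ j, ((x j : ℝ) + (Pi.single i (1 : ℝ) : Fin 3 → ℝ) j) ^ 2 :=
      Finset.sum_congr rfl fun j _ => by
        rw [show ((x + Pi.single i 1 : Site 3) j : ℝ) =
            ((fun j => (x j : ℝ)) + Pi.single i (1 : ℝ) : Fin 3 → ℝ) j from congrFun hcast j]
        rfl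
    have hH1 : H (x + Pi.single i 1) = Φ ((fun j => (x j : ℝ)) + Pi.single i (1 : ℝ)) /
        Real.sqrt (∑ j, ((x j : ℝ) + (Pi.single i (1 : ℝ) : Fin 3 → ℝ) j) ^ 2) := by
      simp only [hH_def]
      rw [hs, hcast]
    have hH0 : H x = Φ (fun j => (x j : ℝ)) / Real.sqrt (∑ j, ((x j : ℝ)) ^ 2) := rfl
    beta_reduce
    rw [hH1, hH0, div_mul_div_comm, div_div_div_eq]
    ring
  -- the CIV asymptotics in ratio form
  have hasymp' : Tendsto (fun x : Site 3 => twoPointPlus 3 β x /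
      (H x * Real.exp (-ξ (fun j => (x j : ℝ))))) cofinite (𝓝 1) := by
    refine hasym.congr' ?_
    filter_upwards [hne] with x hx
    simp only [hH_def]
    have h1 : Real.sqrt (∑ j, ((x j : ℝ)) ^ 2) ≠ 0 := (hsqrt_pos x hx).ne'
    have h2 : Φ (fun j => (x j : ℝ)) ≠ 0 := (hΦpos _ hx).ne'
    rw [Real.exp_neg]
    field_simp
  obtain ⟨c, hc, R, hR⟩ := exists_radius_strictSubharmonic_of_ratioAsymptotics (d := 3)
    (by norm_num) hhom hξpos hC1 hHpos hratio hasymp'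
  refine ⟨c, hc, R, fun x hx => ?_⟩
  have h := hR x hx
  norm_num at h
  exact h

/-- In particular (non-strict form, the subcritical analogue of the route's `EventuallySubharmonic`):
under the Ornstein–Zernike asymptotics at `β > 0` the plus-state two-point function of `ℤ³` is
lattice-subharmonic outside a ball. [folklore] -/
theorem subcritical_eventuallySubharmonic {β : ℝ} (hβ : 0 < β)
    (hOZ : ∃ ξ Φ : (Fin 3 → ℝ) → ℝ,
      (∀ c : ℝ, 0 < c → ∀ y, ξ (c • y) = c * ξ y) ∧ (∀ y, y ≠ 0 → 0 < ξ y) ∧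
      ContDiffOn ℝ 1 ξ {0}ᶜ ∧ (∀ x : Site 3, ξ (fun j => (x j : ℝ)) = dirInvCorrLength 3 β x) ∧
      (∀ c : ℝ, 0 < c → ∀ y, Φ (c • y) = Φ y) ∧ (∀ y, y ≠ 0 → 0 < Φ y) ∧ ContinuousOn Φ {0}ᶜ ∧
      Tendsto (fun x : Site 3 => twoPointPlus 3 β x * Real.sqrt (∑ j, ((x j : ℝ)) ^ 2) *
        Real.exp (ξ (fun j => (x j : ℝ))) / Φ (fun j => (x j : ℝ))) cofinite (𝓝 1)) :
    ∃ R : ℝ, ∀ x : Site 3, R < ‖x‖ →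
      6 * twoPointPlus 3 β x ≤
        ∑ i : Fin 3, (twoPointPlus 3 β (x + Pi.single i 1) + twoPointPlus 3 β (x - Pi.single i 1)) := by
  obtain ⟨c, hc, R, hR⟩ := subcritical_eventually_strictSubharmonic hOZ
  refine ⟨R, fun x hx => le_trans ?_ (hR x hx)⟩
  have h0 : 0 ≤ twoPointPlus 3 β x := (twoPointPlus_pos hβ x).le
  nlinarith

/-- One-line form (registered sub-goal of stmt-CriticalPhenomena-1341), with the hypothesis in the
global shape of the Campanino–Ioffe–Velenik theorem (the Literature named fact
`CIVOrnsteinZernikeAsymptotics3`, `Literature/Probability/LatticeModels/OrnsteinZernikeAsymptotics.lean`,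
proposed separately, is this hypothesis verbatim): OZ asymptotics on `ℤ³` below `β_c(3)` ⇒ eventual
uniformly strict lattice subharmonicity of `⟨σ₀σ_x⟩⁺_β` at every `0 < β < β_c(3)`. [folklore] -/
theorem subcritical_eventually_strictSubharmonic_of_OZ : (∀ β : ℝ, 0 < β → β < criticalBeta 3 → ∃ ξ Φ : (Fin 3 → ℝ) → ℝ, (∀ c : ℝ, 0 < c → ∀ y, ξ (c • y) = c * ξ y) ∧ (∀ y, y ≠ 0 → 0 < ξ y) ∧ ContDiffOn ℝ 1 ξ {0}ᶜ ∧ (∀ x : Site 3, ξ (fun j => (x j : ℝ)) = dirInvCorrLength 3 β x) ∧ (∀ c : ℝ, 0 < c → ∀ y, Φ (c • y) = Φ y) ∧ (∀ y, y ≠ 0 → 0 < Φ y) ∧ ContinuousOn Φ {0}ᶜ ∧ Tendsto (fun x : Site 3 => twoPointPlus 3 β x * Real.sqrt (∑ j, ((x j : ℝ)) ^ 2) * Real.exp (ξ (fun j => (x j : ℝ))) / Φ (fun j => (x j : ℝ))) cofinite (𝓝 1)) → ∀ β : ℝ, 0 < β → β < criticalBeta 3 → ∃ c : ℝ, 0 <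 c ∧ ∃ R : ℝ, ∀ x : Site 3, R < ‖x‖ → (6 + c) * twoPointPlus 3 β x ≤ ∑ i : Fin 3, (twoPointPlus 3 β (x + Pi.single i 1) + twoPointPlus 3 β (x - Pi.single i 1)) :=
  fun hOZ _ hβ hβc => subcritical_eventually_strictSubharmonic (hOZ _ hβ hβc)

end Summit.CriticalPhenomena.Ising3DConformalLimit.Theorems.PerfectScreening.MassiveRegime
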